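import Summits.QuantumFields.BalabanUV.Beta.CovariantTowerCover

/-!
# Beta / CovariantTowerWalks — THE RANDOM-WALK FORM OF THE PARAMETRIX IN ℓ²: (1 − R′)⁻¹ = Σ_{n<N} R′ⁿ + R′ᴺ(1 − R′)⁻¹ with
# ‖tail‖ ≤ qᴺ/(1 − q), R′ⁿ = Σ over BOX-WALKS w : Fin n → {boxes} of the ordered products S_{w₀}⋯ (walk indexing), and the
# resulting expansion Δ′⁻¹ = Σ_{n<N} Σ_w G′₀∘S_w + tail for the k-fold covariant tower operator of the pv21 MODEL
# (unit `b2b-balaban-beta-d4-p2`, GEN 4; item (iii) of `beta/skeletons/D4-NODE-O2-b2b-balaban-beta-d4-p2.md`: the SERIES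
# and its WALK INDEXING; the U-localisation of the individual walk terms is NOT here; imports `CovariantTowerCover` only)

HONEST FRAMING: discharging `BetaPertH` makes Bałaban's UV stability UNCONDITIONAL — NOT the continuum limit, NOT the
Clay problem.  HONEST DEPENDENCY (verbatim): «continuum YM on T⁴ ⇐ BetaPertH ∧ nine spine estimates (0/9 proved);
BetaPertH ⇐ (D1) ∧ (D4) ∧ CAP+tail; G-an2-4 gates asym, D1 and NE2/3/4.»  THIS MODULE DISCHARGES NOTHING of `BetaPertH`,
asserts NOTHING printed and cites nothing as a fact (ABSOLUTE RULE): [folklore] algebra in `Module.End` + the ℓ² bounds of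
`CovariantTowerL2`/`…Parametrix` about the component MODEL of the pv21 chain ([B9] = `Balaban1985BackgroundPropagators`,
Commun. Math. Phys. 99 (1985) 389–434; SHAPES: (3.90)–(3.91) p. 409 «G′ = Σ_{n≥0} G′₀R′ⁿ … a sum over random walks»).

CONTENT.
* §1 `walkProd` (ordered product along a walk w : Fin n → ι: S_{w(n−1)}-first composition ending with S_{w 0}),
  **`pow_sum_eq_sum_walkProd`** ((Σ_z S_z)ⁿ = Σ_{w : Fin n → ι} walkProd S n w — noncommutative expansion by `Fin.consEquiv`),
  `l2Bound_pow`, `l2Bound_walkProd` (‖S_w‖ ≤ Cⁿ).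
* §2 **`inverse_one_sub_eq_geom_add_tail`** ((1 − R)⁻¹ = Σ_{i<N} Rⁱ + Rᴺ(1 − R)⁻¹ for ‖R‖ ≤ q < 1), `l2Bound_tail`
  (‖Rᴺ(1 − R)⁻¹‖ ≤ qᴺ(1 − q)⁻¹), **`parametrix_walk_expansion`**: G′ = G′₀ + G′R′, ‖R′‖ ≤ q < 1, ‖G′₀‖ ≤ C₀ ⇒ for every N,
  G′ = Σ_{n<N} Σ_{w : Fin n → ι} G′₀∘walkProd S n w + G′₀∘R′ᴺ(1 − R′)⁻¹ with ‖tail‖ ≤ C₀qᴺ(1 − q)⁻¹, whenever R′ = Σ_z S_z.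
* §3 `walk_expansion_tower_torus`: the torus instance for Δ′ = Δ_U + Σ_l a_lG_lᵀG_l with the b05 partition of unity (box
  index ι = `Ctr N M₀`, S_z = K(h_z)G′_zh_z, G′₀ = Σ_z h_zG′_zh_z, q = ν_k(M₀)C_rem/M₀ from `CovariantTowerCover`).

NOT HERE (honest scope): the U-LOCALISATION of a walk term (that G′₀∘S_{w} depends on the transport only through the
bonds near the boxes visited) — the half of item (iii) that [II] (2.14)–(2.17) consumes — is the next node; no claim about
print; crude k-dependent constants; ℓ² currency.  Row D4: RECORDS value; class of (T3)/NODE O.2 unchanged; D4 DISCHARGE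
NO DATE; NOT BetaPertH, NOT continuum, NOT Clay.
-/

namespace Summit.QuantumFields.BalabanUV.Beta.CovariantTowerWalks

open Finset
open Literature.MathematicalPhysics.QuantumFieldTheory.Balaban1983to89
open B9Thm37Sum B9Thm37Glue B9Thm37GluePU B9Thm37GlueTorusInv B9Thm37GlueTorusCov B9Thm37GlueTorusCovComp
open B9Thm37GlueTorusCovPoinc (tdepth_le card_block_le)
open B9Thm37GlueTorusCovLevels B9Thm37GlueTorusCovTower B9Thm37GlueTorusCovTowerDir
open B9Thm37GlueTorusCovTowerPU (towerK omegaBall omegaBall_eq_one omegaBall_zero_or_one)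
open Summit.QuantumFields.BalabanUV.Beta.CovariantTowerL2
open Summit.QuantumFields.BalabanUV.Beta.CovariantTowerRemainder
open Summit.QuantumFields.BalabanUV.Beta.CovariantTowerParametrix
open Summit.QuantumFields.BalabanUV.Beta.CovariantTowerLocality
open Summit.QuantumFields.BalabanUV.Beta.CovariantTowerCover
open B5TorusCover (UT Ctr ctrU)
open B5SmoothPartition (hSU)

noncomputable section

/-! ## §1  Walk indexing of the powers of a box sum -/

section Walks

variable {X ι : Type}

/-- MODEL bookkeeping: **the ordered product along a walk** w : Fin n → ι — the empty walk gives 1, and a walk of length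
n + 1 gives (product along its tail)∘S_{w 0}: S_{w 0} acts first. [folklore] -/
def walkProd (S : ι → Module.End ℝ (X → ℝ)) : (n : ℕ) → (Fin n → ι) → Module.End ℝ (X → ℝ)
  | 0, _ => 1
  | n + 1, w => walkProd S n (Fin.tail w) * S (w 0)

/-- The empty walk. [folklore] -/
theorem walkProd_zero (S : ι → Module.End ℝ (X → ℝ)) (w : Fin 0 → ι) : walkProd S 0 w = 1 := rfl

/-- One more step. [folklore] -/
theorem walkProd_succ (S : ι → Module.End ℝ (X → ℝ)) (n : ℕ) (w : Fin (n + 1) → ι) :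
    walkProd S (n + 1) w = walkProd S n (Fin.tail w) * S (w 0) := rfl

variable [Fintype X] [Fintype ι]

omit [Fintype X] in
/-- **NONCOMMUTATIVE MULTINOMIAL EXPANSION**: (Σ_z S_z)ⁿ = Σ_{w : Fin n → ι} walkProd S n w. [folklore] -/
theorem pow_sum_eq_sum_walkProd (S : ι → Module.End ℝ (X → ℝ)) :
    ∀ n : ℕ, (∑ z, S z) ^ n = ∑ w : Fin n → ι, walkProd S n w := by
  intro n
  induction n with
  | zero =>
      rw [pow_zero]
      have huniv : (univ : Finset (Fin 0 → ι)) = {finZeroElim} :=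
        Finset.eq_singleton_iff_unique_mem.mpr ⟨mem_univ _, fun w _ => funext fun i => i.elim0⟩
      rw [huniv, Finset.sum_singleton, walkProd_zero]
  | succ n ih =>
      rw [pow_succ, ih, Finset.sum_mul]
      simp_rw [Finset.mul_sum]
      rw [← (Fin.consEquiv fun _ : Fin (n + 1) => ι).sum_comp, Fintype.sum_prod_type, Finset.sum_comm]
      refine Finset.sum_congr rfl fun a _ => Finset.sum_congr rfl fun t _ => ?_
      show walkProd S n t * S a =
        walkProd S n (Fin.tail (Fin.cons (α := fun _ : Fin (n + 1) => ι) a t)) *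
          S (Fin.cons (α := fun _ : Fin (n + 1) => ι) a t 0)
      rw [Fin.tail_cons, Fin.cons_zero]

/-- Powers: ‖Rⁿ‖ ≤ qⁿ. [folklore] -/
theorem l2Bound_pow {R : Module.End ℝ (X → ℝ)} {q : ℝ} (hR : L2Bound R q) : ∀ n : ℕ, L2Bound (R ^ n) (q ^ n) := by
  intro n
  induction n with
  | zero =>
      rw [pow_zero, pow_zero]
      exact ⟨zero_le_one, fun v => by simp⟩
  | succ n ih =>
      rw [pow_succ, pow_succ]
      exact ih.comp hR

omit [Fintype ι] in
/-- Walks: ‖walkProd S n w‖ ≤ Cⁿ when every ‖S_z‖ ≤ C. [folklore] -/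
theorem l2Bound_walkProd (S : ι → Module.End ℝ (X → ℝ)) {C : ℝ} (hS : ∀ z, L2Bound (S z) C) :
    ∀ (n : ℕ) (w : Fin n → ι), L2Bound (walkProd S n w) (C ^ n) := by
  intro n
  induction n with
  | zero => intro w; rw [walkProd_zero, pow_zero]; exact ⟨zero_le_one, fun v => by simp⟩
  | succ n ih => intro w; rw [walkProd_succ, pow_succ]; exact (ih (Fin.tail w)).comp (hS (w 0))

/-! ## §2  Geometric decomposition of (1 − R)⁻¹ with an ℓ²-small tail, and the walk expansion of the parametrix -/

/-- **(1 − R)⁻¹ = Σ_{i<N} Rⁱ + Rᴺ(1 − R)⁻¹** for ‖R‖ ≤ q < 1 (1 − R is a unit, `isUnit_one_sub`; `geom_sum_mul_neg`). [folklore] -/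
theorem inverse_one_sub_eq_geom_add_tail {R : Module.End ℝ (X → ℝ)} {q : ℝ} (hR : L2Bound R q) (hq : q < 1) (Nn : ℕ) :
    Ring.inverse (1 - R) = (∑ i ∈ range Nn, R ^ i) + R ^ Nn * Ring.inverse (1 - R) := by
  have hU := isUnit_one_sub hR hq
  have hgeo : (∑ i ∈ range Nn, R ^ i) * (1 - R) = 1 - R ^ Nn := geom_sum_mul_neg R Nn
  have h1 : (∑ i ∈ range Nn, R ^ i) = (1 - R ^ Nn) * Ring.inverse (1 - R) := by
    calc (∑ i ∈ range Nn, R ^ i) = (∑ i ∈ range Nn, R ^ i) * ((1 - R) * Ring.inverse (1 - R)) := by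
          rw [Ring.mul_inverse_cancel _ hU, mul_one]
      _ = (1 - R ^ Nn) * Ring.inverse (1 - R) := by rw [← mul_assoc, hgeo]
  rw [h1, sub_mul, one_mul, sub_add_cancel]

/-- **The tail is ℓ²-small**: ‖Rᴺ(1 − R)⁻¹‖ ≤ qᴺ·(1 − q)⁻¹. [folklore] -/
theorem l2Bound_tail {R : Module.End ℝ (X → ℝ)} {q : ℝ} (hR : L2Bound R q) (hq : q < 1) (Nn : ℕ) :
    L2Bound (R ^ Nn * Ring.inverse (1 - R)) (q ^ Nn * (1 - q)⁻¹) :=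
  (l2Bound_pow hR Nn).comp (l2Bound_inverse_one_sub hR hq)

/-- **THE RANDOM-WALK EXPANSION OF THE PARAMETRIX IN ℓ² (abstract; MODEL of the (3.90)–(3.91) shape).**  From G′ = G′₀ + G′R′
with R′ = Σ_z S_z, ‖R′‖ ≤ q < 1, ‖G′₀‖ ≤ C₀: for every N,
G′ = Σ_{n<N} Σ_{w : Fin n → ι} G′₀∘walkProd S n w + G′₀∘R′ᴺ∘(1 − R′)⁻¹, and the tail has ‖·‖ ≤ C₀·qᴺ·(1 − q)⁻¹. [folklore] -/
theorem parametrix_walk_expansion {G G0 : Module.End ℝ (X → ℝ)} (S : ι → Module.End ℝ (X → ℝ))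
    (hfix : G = G0 + G * ∑ z, S z) {q C0 : ℝ} (hR : L2Bound (∑ z, S z) q) (hq : q < 1) (hG0 : L2Bound G0 C0)
    (Nn : ℕ) :
    G = (∑ n ∈ range Nn, ∑ w : Fin n → ι, G0 * walkProd S n w) +
        G0 * ((∑ z, S z) ^ Nn * Ring.inverse (1 - ∑ z, S z)) ∧
      L2Bound (G0 * ((∑ z, S z) ^ Nn * Ring.inverse (1 - ∑ z, S z))) (C0 * (q ^ Nn * (1 - q)⁻¹)) := by
  obtain ⟨hG, -⟩ := parametrix_l2 hfix hR hq hG0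
  refine ⟨?_, hG0.comp (l2Bound_tail hR hq Nn)⟩
  calc G = G0 * Ring.inverse (1 - ∑ z, S z) := hG
    _ = G0 * ((∑ i ∈ range Nn, (∑ z, S z) ^ i) + (∑ z, S z) ^ Nn * Ring.inverse (1 - ∑ z, S z)) := by
        rw [← inverse_one_sub_eq_geom_add_tail hR hq Nn]
    _ = (∑ n ∈ range Nn, ∑ w : Fin n → ι, G0 * walkProd S n w) +
        G0 * ((∑ z, S z) ^ Nn * Ring.inverse (1 - ∑ z, S z)) := by
        rw [mul_add, Finset.mul_sum]
        congr 1
        refine Finset.sum_congr rfl fun n _ => ?_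
        rw [pow_sum_eq_sum_walkProd S n, Finset.mul_sum]

end Walks

/-! ## §3  The torus: the walk expansion of Δ′⁻¹ for the k-fold covariant tower operator -/

section Torus

variable {d : ℕ} {N : Fin d → ℕ} [∀ i, NeZero (N i)] [NeZero d]

/-- **RANDOM-WALK EXPANSION OF Δ′⁻¹ IN ℓ² FOR THE k-FOLD COVARIANT TOWER OPERATOR ON THE TORUS (MODEL)**: with the boxes z
of the b05 partition of unity at scale M₀, S_z = K(h_z)G′_zh_z, G′₀ = Σ_z h_zG′_zh_z and q = (C_rem/M₀)·√(ν_k(M₀)²) < 1: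
for every N,  Δ′⁻¹ = Σ_{n<N} Σ_{w : Fin n → boxes} G′₀∘S_{w} + G′₀∘R′ᴺ(1 − R′)⁻¹ with
‖tail‖_{ℓ²} ≤ σ_k⁻¹√(ν_k(M₀)²)·qᴺ·(1 − q)⁻¹ — every torus, every isometric transport. [folklore] -/
theorem walk_expansion_tower_torus {Cp : Type} [Fintype Cp] [DecidableEq Cp] {M : ℕ → ℕ} (hM : ∀ j, 1 ≤ M j)
    (hdiv : ∀ j i, M j ∣ N i) (c : UT N × Fin d → ℝ) {cmin cmax : ℝ} (hcmin : 0 < cmin) (hc : ∀ b, cmin ≤ |c b|)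
    (hc' : ∀ b, |c b| ≤ cmax) (Rm : UT N × Fin d → Cp → Cp → ℝ)
    (hRm : ∀ b i j, ∑ k, Rm b k i * Rm b k j = if i = j then (1 : ℝ) else 0) (k : ℕ) (ω : Fin (k + 1) → ℝ)
    {wmax : ℝ} (hw' : ∀ l, |ω l| ≤ wmax) {a : Fin (k + 1) → ℝ} (ha : ∀ l, 0 ≤ a l) {amin wmin : ℝ}
    (hamin : 0 < amin) (hwmin : 0 < wmin) (hak : amin ≤ a (Fin.last k)) (hωk : wmin ≤ |ω (Fin.last k)|)
    {M₀ : ℕ} (hM₀ : 1 ≤ M₀) (hdiv₀ : ∀ i, M₀ ∣ N i) (h2N : ∀ i, 2 * M₀ ≤ N i)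
    (hlarge : remConstTower d M amin wmin cmin cmax wmax k a / M₀ *
      Real.sqrt (coverNumber d M k M₀ * coverNumber d M k M₀) < 1) (Nn : ℕ) :
    let Δ' := towerOp (torusTower hM hdiv) Rm c k (fun l _ => ω l) a
    let S : Ctr N M₀ → Module.End ℝ (UT N × Cp → ℝ) := fun z =>
      towerK (torusTower hM hdiv) Rm c k (fun l _ => ω l) a (hSU N M₀ z) *
        dirInv Δ' (omegaBall hM hdiv k M₀ z ∘ Prod.fst) * mulOp (hSU N M₀ z ∘ Prod.fst)
    let G0 : Module.End ℝ (UT N × Cp → ℝ) := ∑ z : Ctr N M₀, mulOp (hSU N M₀ z ∘ Prod.fst) *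
      dirInv Δ' (omegaBall hM hdiv k M₀ z ∘ Prod.fst) * mulOp (hSU N M₀ z ∘ Prod.fst)
    Ring.inverse Δ' = (∑ n ∈ range Nn, ∑ w : Fin n → Ctr N M₀, G0 * walkProd S n w) +
        G0 * ((∑ z, S z) ^ Nn * Ring.inverse (1 - ∑ z, S z)) ∧
      L2Bound (G0 * ((∑ z, S z) ^ Nn * Ring.inverse (1 - ∑ z, S z)))
        ((sigmaTowerTorus d M amin wmin cmin k)⁻¹ * Real.sqrt (coverNumber d M k M₀ * coverNumber d M k M₀) *
          ((remConstTower d M amin wmin cmin cmax wmax k a / M₀ *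
              Real.sqrt (coverNumber d M k M₀ * coverNumber d M k M₀)) ^ Nn *
            (1 - remConstTower d M amin wmin cmin cmax wmax k a / M₀ *
              Real.sqrt (coverNumber d M k M₀ * coverNumber d M k M₀))⁻¹)) := by
  intro Δ' S G0
  have hν := coverNumber_nonneg d M k M₀
  have hσ := sigmaTowerTorus_pos d M cmin k hamin hwmin
  -- the fixed point (pv21) and the two box-sum bounds, as in `parametrix_l2_tower_torus_top`
  have hfix : Ring.inverse Δ' = G0 + Ring.inverse Δ' * ∑ z, S z :=
    B9Thm37GlueTorusCovTowerPU.fixedPoint_tower_torus_top hM hdiv hRm hcmin hc k ω ha hamin hwmin hak hωk hM₀ hdiv₀ h2N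
  -- input/output localisation and per-box bounds
  have hMχ : ∀ z, (mulOp (hSU N M₀ z ∘ Prod.fst) * mulOp (omegaBall hM hdiv k M₀ z ∘ Prod.fst) :
      Module.End ℝ (UT N × Cp → ℝ)) = mulOp (hSU N M₀ z ∘ Prod.fst) := fun z =>
    mulOp_mul_mulOp_of_mul_eq fun p => hSU_mul_eq_of_one hM₀ z (fun _ hx => omegaBall_eq_one hM hdiv k M₀ z hx) p.1
  have h01 : ∀ z (p : UT N × Cp), (omegaBall hM hdiv k M₀ z ∘ Prod.fst) p = 0 ∨
      (omegaBall hM hdiv k M₀ z ∘ Prod.fst) p = 1 := fun z p => omegaBall_zero_or_one hM hdiv k M₀ z p.1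
  have hinS : ∀ z, S z * mulOp (omegaBall hM hdiv k M₀ z ∘ Prod.fst) = S z := fun z => by
    show towerK (torusTower hM hdiv) Rm c k (fun l _ => ω l) a (hSU N M₀ z) *
        dirInv Δ' (omegaBall hM hdiv k M₀ z ∘ Prod.fst) * mulOp (hSU N M₀ z ∘ Prod.fst) *
        mulOp (omegaBall hM hdiv k M₀ z ∘ Prod.fst) = _
    rw [mul_assoc, hMχ z]
  have hinT : ∀ z, mulOp (hSU N M₀ z ∘ Prod.fst) * dirInv Δ' (omegaBall hM hdiv k M₀ z ∘ Prod.fst) *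
      mulOp (hSU N M₀ z ∘ Prod.fst) * mulOp (omegaBall hM hdiv k M₀ z ∘ Prod.fst) =
      mulOp (hSU N M₀ z ∘ Prod.fst) * dirInv Δ' (omegaBall hM hdiv k M₀ z ∘ Prod.fst) *
      mulOp (hSU N M₀ z ∘ Prod.fst) := fun z => by rw [mul_assoc, hMχ z]
  have houtT : ∀ z v p, (omegaBall hM hdiv k M₀ z ∘ Prod.fst) p = 0 →
      (mulOp (hSU N M₀ z ∘ Prod.fst) * dirInv Δ' (omegaBall hM hdiv k M₀ z ∘ Prod.fst) *
        mulOp (hSU N M₀ z ∘ Prod.fst) : Module.End ℝ (UT N × Cp → ℝ)) v p = 0 := fun z v p hp => by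
    simp only [Function.comp_apply] at hp
    simp only [Module.End.mul_apply, mulOp_apply, Function.comp_apply]
    rw [hSU_eq_zero_of_chiBall_eq_zero hM₀ z p.1 ?_, zero_mul]
    have hle := chiBall_le_omegaBall hM hdiv k M₀ z p.1
    rw [hp] at hle
    rcases chiBall_zero_or_one M₀ z p.1 with h0 | h1
    · exact h0
    · rw [h1] at hle; exact absurd hle (by norm_num)
  have hSz : ∀ z, L2Bound (S z) (remConstTower d M amin wmin cmin cmax wmax k a / M₀) := fun z =>
    remainderTerm_le_torus_top hM hdiv c hcmin hc hc' Rm hRm k ω hw' ha hamin hwmin hak hωk (h01 z) hM₀ z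
  have hTz : ∀ z, L2Bound (mulOp (hSU N M₀ z ∘ Prod.fst) * dirInv Δ' (omegaBall hM hdiv k M₀ z ∘ Prod.fst) *
      mulOp (hSU N M₀ z ∘ Prod.fst)) (sigmaTowerTorus d M amin wmin cmin k)⁻¹ := fun z => by
    have hG := l2Bound_dirInv_tower (torusTower hM hdiv) Rm hRm hcmin hc (fun j x => tdepth_le (hM j) x)
      (fun j β => card_block_le (hM j) (hdiv j) β) k (fun l _ => ω l) ha hamin hwmin (h01 z)
      (fun _ _ _ => ⟨Fin.last k, hak, hωk⟩)
    have hMz : L2Bound (mulOp (hSU N M₀ z ∘ Prod.fst) : Module.End ℝ (UT N × Cp → ℝ)) 1 :=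
      l2Bound_mulOp zero_le_one fun p => hh_torus M₀ z p.1
    exact ((hMz.comp hG).comp hMz).mono (le_of_eq (by rw [sigmaTowerTorus]; ring))
  have hC0 : 0 ≤ remConstTower d M amin wmin cmin cmax wmax k a / M₀ :=
    div_nonneg (remConstTower_nonneg d M hamin hwmin cmin cmax wmax k ha) (Nat.cast_nonneg _)
  have hcount : ∀ p : UT N × Cp, ∑ z : Ctr N M₀, (omegaBall hM hdiv k M₀ z ∘ Prod.fst) p ≤ coverNumber d M k M₀ :=
    fun p => sum_omegaBall_le hM hdiv k hM₀ p.1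
  have hR : L2Bound (∑ z, S z) (remConstTower d M amin wmin cmin cmax wmax k a / M₀ *
      Real.sqrt (coverNumber d M k M₀ * coverNumber d M k M₀)) :=
    l2Bound_sum_of_overlap S _ _ h01 h01 hinS
      (fun z v p hp => remainderTerm_support hM hdiv c Rm k (fun l _ => ω l) a hM₀ z _ v p hp) hC0 hSz hν hν
      hcount hcount
  have hG0 : L2Bound G0 ((sigmaTowerTorus d M amin wmin cmin k)⁻¹ *
      Real.sqrt (coverNumber d M k M₀ * coverNumber d M k M₀)) :=
    l2Bound_sum_of_overlap _ _ _ h01 h01 hinT houtT (inv_nonneg.mpr hσ.le) hTz hν hν hcount hcount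
  exact parametrix_walk_expansion S hfix hR hlarge hG0 Nn

end Torus

end

end Summit.QuantumFields.BalabanUV.Beta.CovariantTowerWalks
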